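import Literature.MathematicalPhysics.QuantumFieldTheory.Balaban1983to89.B15Sect1Statements
import Literature.MathematicalPhysics.QuantumFieldTheory.Balaban1983to89.Node00.DatumAvLayer

/-!
# NODE 00 — DEFINER ₇, v2 (DRAFT, successor of `Node00/ROperationOfRecord.lean`): `R` of record as the BASIC STEP 𝐑′ (1.100)
# [IV] p. 201 on the (1.100)-represented tower of record, the identity elsewhere; (0.4) = (1.102) and integrability as THEOREMS

Seat `pub-ymgap-node00-def-R` (DEFINER ₇).  [IV] = [Balaban1989LargeFieldI].  DRAFT — not filed; the name `ROfRecord` is the one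
node00-def's DEFINER-SPEC §2 (r0) reserves for the §1 version.

WHAT THIS FILE IS.  r12 typed (1.100) as an OBJECT: `B15Sect1Statements.RPrimeData` (regions `Z_k`, the 𝕋″-operation forms, the
insert families (1.100)'s `Family1100 ∕ Component1100 ∕ Insert1100` with parts-denominators as p. 177 says, `exp A″_k`) and
`rPrime1100 D : Density`; (1.102) as `Normalization1102 D ρ`; and foresaw the operator form through a representation
`rep : Density → RPrimeData` (`eq1102_iff_normalization1102`).  v2 of `R` of record is that operator form, TOTALISED as in v1
(chair R434 (c1)) by the UNIFORM mechanism `totalOp` of §1a (any assembled-density reader; v3 = [B16] (1.72) will be its next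
instance): at a density `ρ` whose extracted datum `rep p k ρ` satisfies print's normalization property (1.102) and yields an
integrable density, `R ρ := 𝐑′ρ = rPrime1100 (rep p k ρ)`; elsewhere `R ρ := ρ`.  CONSEQUENCE: `Residual₅.preservesIntegral_R` and
`integrable_R` are THEOREMS for every density BY CONSTRUCTION.  HONEST LIMIT, said plainly: the (0.4) theorem for the TOTAL operator
carries no analytic content — the content of print's (1.102) («the 𝐑′-operation changes essentially the initial density only in a
neighborhood of the large field region», Prop. 1 ∕ (1.80) ∕ (1.89)) is the statement that THE TOWER'S densities are admissible, i.e.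
that `R` of record acts as 𝐑′ along the record — r12's `normalization1102_of_fibreModel` route, an N12-side theorem, NOT asserted
here.  The extraction `rep1100` is the stage-₇ residual (to be pinned by ₇b from [IV] §1 (1.3)–(1.10), (1.71)–(1.76), (1.99)).

Nothing of Bałaban's is asserted.  No `instance`, no `notation`, no `sorry`.  HONEST FRAMING: definitions of record + kernel
bookkeeping; counts unmoved; NOT continuum ∕ OS ∕ mass-gap ∕ Clay.
-/

noncomputable section

open MeasureTheory

namespace Literature.MathematicalPhysics.QuantumFieldTheory.Balaban1983to89.Node00

open T4Continuum B15Sect1Statements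

variable (F : T4Family) (N : ℕ) [NeZero N]

/-- **The (1.100)-representation extraction** (stage-₇ residual, v2): for each run `p` and step `k`, the datum of 𝐑′ (1.100) —
regions `Z_k`, 𝕋″-forms, insert families, `exp A″_k` — READ AT a density of `T^{(k+1)}` (the represented tower of record there;
conventional elsewhere). [cite: Balaban1989LargeFieldI, (1.100) p.201] -/
abbrev Rep1100OfRecord : Type 1 :=
  (p : B12.RunParams) → (k : ℕ) → Density (F.P p.K) (k + 1) (SU N) → RPrimeData (F.P p.K) (k + 1) (SU N)

section Generic

variable {P : Params} {j : ℕ} {G : Type*} [GaugeGroup G] [MeasurableSpace G] [HaarData G]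

/-! ### §1a The uniform totalisation mechanism (any assembled-density reader) -/

/-- **Admissibility of a density `ρ` for an assembled density `ρ'`** (the provisos under which the printed branch is taken,
uniformly for v1∕v2∕v3): `ρ'` has the same integral as `ρ` — print's normalisation property, (0.4) p. 176 ∕ (1.102) p. 201 ∕ the
«equivalent, but not equal» of [B16] p. 378 (equal integrals, the sense of (1.99) [IV]) — AND `ρ'` is integrable.  Print PROVES
these for the densities of the induction; nothing is asserted here. [cite: Balaban1989LargeFieldI, (0.4) p.176; (1.102) p.201] -/
def AdmissibleOut (ρ' ρ : Density P j G) : Prop :=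
  ∫ V, ρ' V ∂(fieldMeasure P j G) = ∫ V, ρ V ∂(fieldMeasure P j G) ∧ Integrable ρ' (fieldMeasure P j G)

open Classical in
/-- **The total operator of an assembled-density reader** `out : Density → Density` (the datum of the printed operation READ AT
a density and assembled by the printed formula): `out ρ` on admissible `ρ`, the identity elsewhere — chair R434 (c1) «Bałaban's
operation on the represented tower of record, conventional elsewhere». [cite: Balaban1989LargeFieldI, (0.3) p.176 (typing convention)] -/
def totalOp (out : Density P j G → Density P j G) (ρ : Density P j G) : Density P j G :=
  if AdmissibleOut (out ρ) ρ then out ρ else ρ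

open Classical in
/-- The printed branch. [cite: Balaban1989LargeFieldI, (0.3) p.176 (bookkeeping)] -/
theorem totalOp_of_admissible {out : Density P j G → Density P j G} {ρ : Density P j G}
    (h : AdmissibleOut (out ρ) ρ) : totalOp out ρ = out ρ :=
  if_pos h

open Classical in
/-- The conventional branch. [cite: Balaban1989LargeFieldI, (0.3) p.176 (typing convention)] -/
theorem totalOp_of_not {out : Density P j G → Density P j G} {ρ : Density P j G}
    (h : ¬ AdmissibleOut (out ρ) ρ) : totalOp out ρ = ρ :=
  if_neg h

open Classical in
/-- **(0.4) ∕ (1.102) for a total operator, every density** — by construction. [cite: Balaban1989LargeFieldI, (0.4) p.176] -/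
theorem preservesIntegral_totalOp (out : Density P j G → Density P j G) : PreservesIntegral (totalOp out) := by
  intro ρ
  by_cases h : AdmissibleOut (out ρ) ρ
  · rw [totalOp_of_admissible h]; exact h.1
  · rw [totalOp_of_not h]

open Classical in
/-- A total operator preserves integrability, every density — by construction. [cite: Balaban1989LargeFieldI, (0.4) p.176 (bookkeeping)] -/
theorem integrable_totalOp (out : Density P j G → Density P j G) {ρ : Density P j G}
    (hρ : Integrable ρ (fieldMeasure P j G)) : Integrable (totalOp out ρ) (fieldMeasure P j G) := by
  by_cases h : AdmissibleOut (out ρ) ρ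
  · rw [totalOp_of_admissible h]; exact h.2
  · rw [totalOp_of_not h]; exact hρ

open Classical in
/-- On an admissible TOWER (every density in `S` admissible and `out` maps `S` into `S`) the total operator IS the printed one along
`S` — the form in which an N12-side discharge of the provisos turns `R` of record into print's `R` on the record's densities.
[cite: Balaban1989LargeFieldI, (0.3)–(0.4) p.176 (bookkeeping)] -/
theorem totalOp_eq_on {out : Density P j G → Density P j G} {S : Set (Density P j G)}
    (hS : ∀ ρ ∈ S, AdmissibleOut (out ρ) ρ) {ρ : Density P j G} (hρ : ρ ∈ S) : totalOp out ρ = out ρ :=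
  totalOp_of_admissible (hS ρ hρ)

/-! ### §1b The (1.100) instance -/

/-- **Admissibility of a density for 𝐑′ at a (1.100) datum** = r12's `Normalization1102 D ρ` (print's (1.102) p. 201
*"∫dV_k(𝐑′ρ_k)(V_k) = ∫dV_kρ_k(V_k)"*) AND integrability of `rPrime1100 D`. [cite: Balaban1989LargeFieldI, (1.102) p.201] -/
def Admissible1100 [DecidableEq (PBond P j)] (D : RPrimeData P j G) (ρ : Density P j G) : Prop :=
  AdmissibleOut (rPrime1100 D) ρ

/-- `Admissible1100` unfolds to (1.102) ∧ integrability. [cite: Balaban1989LargeFieldI, (1.102) p.201 (bookkeeping)] -/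
theorem admissible1100_iff [DecidableEq (PBond P j)] (D : RPrimeData P j G) (ρ : Density P j G) :
    Admissible1100 D ρ ↔ Normalization1102 D ρ ∧ Integrable (rPrime1100 D) (fieldMeasure P j G) := Iff.rfl

open Classical in
/-- **The total 𝐑′-operator at an extraction** `rep`: (1.100) on admissible densities, the identity elsewhere.
[cite: Balaban1989LargeFieldI, (1.100) p.201] -/
def rPrimeTotal (rep : Density P j G → RPrimeData P j G) : Density P j G → Density P j G :=
  totalOp fun ρ => rPrime1100 (rep ρ)

open Classical in
/-- The printed branch. [cite: Balaban1989LargeFieldI, (1.100) p.201 (bookkeeping)] -/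
theorem rPrimeTotal_of_admissible {rep : Density P j G → RPrimeData P j G} {ρ : Density P j G}
    (h : Admissible1100 (rep ρ) ρ) : rPrimeTotal rep ρ = rPrime1100 (rep ρ) :=
  totalOp_of_admissible h

open Classical in
/-- The conventional branch. [cite: Balaban1989LargeFieldI, (1.100) p.201 (typing convention)] -/
theorem rPrimeTotal_of_not {rep : Density P j G → RPrimeData P j G} {ρ : Density P j G}
    (h : ¬ Admissible1100 (rep ρ) ρ) : rPrimeTotal rep ρ = ρ :=
  totalOp_of_not h

open Classical in
/-- **(1.102) ∕ (0.4) for the total 𝐑′-operator, every density** (by construction). [cite: Balaban1989LargeFieldI, (1.102) p.201] -/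
theorem preservesIntegral_rPrimeTotal (rep : Density P j G → RPrimeData P j G) : PreservesIntegral (rPrimeTotal rep) :=
  preservesIntegral_totalOp _

open Classical in
/-- The total 𝐑′-operator preserves integrability, every density. [cite: Balaban1989LargeFieldI, (1.100)–(1.102) p.201 (bookkeeping)] -/
theorem integrable_rPrimeTotal (rep : Density P j G → RPrimeData P j G) {ρ : Density P j G}
    (hρ : Integrable ρ (fieldMeasure P j G)) : Integrable (rPrimeTotal rep ρ) (fieldMeasure P j G) :=
  integrable_totalOp _ hρ

open Classical in
/-- On the printed branch `B15.BasicStep.Eq1102` holds for the operator `ρ' ↦ rPrime1100 (rep ρ')` at `ρ` (r12's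
`eq1102_iff_normalization1102`). [cite: Balaban1989LargeFieldI, (1.102) p.201 (bookkeeping)] -/
theorem eq1102_of_admissible {rep : Density P j G → RPrimeData P j G} {ρ : Density P j G}
    (h : Admissible1100 (rep ρ) ρ) : B15.BasicStep.Eq1102 (fun ρ' => rPrime1100 (rep ρ')) ρ :=
  (eq1102_iff_normalization1102 rep ρ).2 h.1

end Generic

open Classical in
/-- **`R` OF RECORD (v2)** — [IV] (1.100) p. 201 𝐑′ (*"not a complete 𝐑-operation yet, but … a basic part of it"*) on the
(1.100)-represented tower of record, the identity elsewhere; fills `Residual₅.R`. [cite: Balaban1989LargeFieldI, (1.100) p.201] -/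
def ROfRecord (rep : Rep1100OfRecord F N) (p : B12.RunParams) (k : ℕ) :
    Density (F.P p.K) (k + 1) (SU N) → Density (F.P p.K) (k + 1) (SU N) :=
  rPrimeTotal (rep p k)

open Classical in
/-- **(0.4) [IV] p. 176 ∕ (1.102) p. 201 for `R` of record (v2), every density** — `Residual₅.preservesIntegral_R`'s exact shape.
[cite: Balaban1989LargeFieldI, (1.102) p.201] -/
theorem preservesIntegral_ROfRecord (rep : Rep1100OfRecord F N) :
    ∀ (p : B12.RunParams) (k : ℕ), k < p.K → PreservesIntegral (ROfRecord F N rep p k) :=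
  fun p k _ => preservesIntegral_rPrimeTotal (rep p k)

open Classical in
/-- `R` of record (v2) preserves integrability, every density — `Residual₅.integrable_R`'s exact shape.
[cite: Balaban1989LargeFieldI, (1.100)–(1.102) p.201 (bookkeeping)] -/
theorem integrable_ROfRecord (rep : Rep1100OfRecord F N) :
    ∀ (p : B12.RunParams) (k : ℕ), k < p.K → ∀ ρ : Density (F.P p.K) (k + 1) (SU N),
      Integrable ρ (fieldMeasure (F.P p.K) (k + 1) (SU N)) →
        Integrable (ROfRecord F N rep p k ρ) (fieldMeasure (F.P p.K) (k + 1) (SU N)) :=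
  fun p k _ _ hρ => integrable_rPrimeTotal (rep p k) hρ

end Literature.MathematicalPhysics.QuantumFieldTheory.Balaban1983to89.Node00

end
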